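import Literature.IUT.HodgeTheaters.FKitCoreBridge
import Literature.IUT.HodgeTheaters.KitCoreBridgeWitness
import Mathlib.CategoryTheory.Core
import HarnessLib

/-!
# `FKitCore(S, 𝔉K)` is consistent: over the thickened kits of `KitCoreBridgeWitness.lean`, the ℱ-kit whose
# ℱ-data ARE the isomorphs of the 𝒟-data core-agrees with a §5-R4 stub built from the same data
# (KIT-RULE inhabitant of `S5Local.FKitCore`, with `c.e` bijective)

S. Mochizuki, *Inter-universal Teichmüller theory I*, kurims manuscript (May 2020), Def 5.2 (i) p. 134, Rmk 5.2.1
(i) p. 143, Def 3.6 p. 87, p. 147 ([IUTchI] Def 5.2 (i) p.134) [claim: Mochizuki2012, status: disputed] (D-0012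
claim key; CONSISTENCY MODEL for the bridge structure `BaseThetaDatum.S5Local.FKitCore` of `FKitCoreBridge.lean` —
nothing of the series is asserted, no side is taken on [IUTchIII] Cor. 3.12).

The cell's KIT-RULE asks that every hypothesis structure be shown inhabited, so that no theorem over it is vacuous.
This file builds, for ANY base kit `K'` and multiplicative kit `M`, the ℱ-kit `FKit.ofBase K' M` whose ℱ-side ambient
categories are the full subcategories of isomorphs of the models `𝒟_v` ("ℱ-data := 𝒟-data", base functor the
inclusion, `𝔉^⊩`-data the product over `𝕍`), and, over abc-iut-L5-t3's thickened datum `thickDatum K` of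
`KitCoreBridgeWitness.lean` (whose `KitCore` `thickCore` has `e = id`), a §5-R4 stub `thickS5Local K` with the SAME
local categories, Θ-Hodge theaters := the core groupoid of families of isomorphs, and the trivial global data of the
thickened model; then `thickFKitCore K : (thickS5Local K).FKitCore (thickCore K) (FKit.ofBase K.thicken _)` with all
comparison functors identities — every field of `FKitCore` checked by the kernel — and the packaged
`exists_fKitCore` (with `c.e` bijective and `𝕍^bad ≠ ∅`).  Consistency/plumbing only; typed ≠ proved elsewhere.
-/

namespace Literature.IUT.HodgeTheaters

open CategoryTheory

namespace PMBaseKit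

universe u

variable {l : ℕ}

/-! ### An ℱ-kit over any base kit: ℱ-data := isomorphs of the 𝒟-data -/

/-- **An `ℱ`-prime-strip kit over ANY base kit** (consistency plumbing for abc-iut-L5-t4's `FKit`, Def 5.2 (i)–(iv)):
the ambient categories of `ℱ_v`-, `ℱ^⊢_v`- and `ℱ̲_v`-data are all the full subcategory of isomorphs of the model
`𝒟_v`, the base functor `𝔉 ↦ 𝔇` of Rmk 5.2.1 (i) is the inclusion, mono-analyticisation and `ℱ̲_v ↦ ℱ_v` are
identities, the `𝔉^⊩`-data are families indexed by `𝕍` with `rlfFm v` the evaluation (as in `FKit.toy`), and the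
`𝒟^⊢`-side is read through `M.mono`.  No claim that this is print's kit.
([IUTchI] Def 5.2 (i) p.134) [claim: Mochizuki2012, status: disputed] -/
noncomputable def FKit.ofBase (K' : PMBaseKit.{u} l) (M : K'.MultKit) : K'.FKit M where
  FAmb x := ObjectProperty.FullSubcategory (K'.IsLocal x)
  fModel x := ⟨K'.model x, K'.isLocal_model x⟩
  FmAmb x := ObjectProperty.FullSubcategory (K'.IsLocal x)
  fmModel x := ⟨K'.model x, K'.isLocal_model x⟩
  toD x := ObjectProperty.ι (K'.IsLocal x)
  toD_model _ := Iso.refl _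
  toFm _ := 𝟭 _
  toFm_model _ := Iso.refl _
  RlfAmb := ∀ x, ObjectProperty.FullSubcategory (K'.IsLocal x)
  rlfModel := fun x => ⟨K'.model x, K'.isLocal_model x⟩
  rlfFm x := Pi.eval _ x
  rlfOf F := F
  rlfOfMap φ := Pi.isoMk φ
  rlfFm_rlfOf _ _ := Iso.refl _
  ThAmb x := ObjectProperty.FullSubcategory (K'.IsLocal x)
  thModel x := ⟨K'.model x, K'.isLocal_model x⟩
  thToF _ := 𝟭 _
  thToF_model _ := Iso.refl _
  toDm F := M.mono ⟨fun v => (F v).obj, fun v => (F v).property⟩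
  toDmMap φ := M.monoMap fun v => (ObjectProperty.ι _).mapIso (φ v)
  toDm_toFm _ _ := ⟨𝟙 _⟩

/-! ### Cor 5.3 (ii) and Cor 5.6 (i) (kit form) HOLD for `FKit.ofBase` -/

/-- The inclusion of the isomorphs of `𝒟_v` is bijective on isomorphisms (category-theory plumbing). [folklore] -/
private theorem ι_mapIso_bijective {C : Type*} [Category C] (P : ObjectProperty C) (X Y : P.FullSubcategory) :
    Function.Bijective (P.ι.mapIso : (X ≅ Y) → (P.ι.obj X ≅ P.ι.obj Y)) := by
  refine ⟨fun a b h => Iso.ext (P.fullyFaithfulι.map_injective (congrArg Iso.hom h)),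
    fun e => ⟨P.fullyFaithfulι.preimageIso e, ?_⟩⟩
  ext
  simp [Functor.FullyFaithful.preimageIso]

/-- `(a ≫ f ≫ b⁻¹) ≫ b = a ≫ f` for isomorphisms `a`, `b` (category-theory plumbing). [folklore] -/
private theorem comp_inv_comp_hom_aux {C : Type*} [Category C] {A B X Y : C} (a : A ≅ X) (f : X ⟶ Y) (b : B ≅ Y) :
    (a.hom ≫ f ≫ b.inv) ≫ b.hom = a.hom ≫ f := by
  simp

/-- **Cor 5.3 (ii) HOLDS for the ℱ-kit `FKit.ofBase`** (its base functor is the fully faithful inclusion of the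
isomorphs of `𝒟_v`): the natural map `Isom(¹𝔉, ²𝔉) → Isom(¹𝔇, ²𝔇)` is bijective — via abc-iut-L5-d4's
`isomFtoDBijective_of_model`. ([IUTchI] Cor 5.3 (ii) p.144) [claim: Mochizuki2012, status: disputed] -/
theorem isomFtoDBijective_ofBase (K' : PMBaseKit.{u} l) (M : K'.MultKit) : (FKit.ofBase K' M).IsomFtoDBijective :=
  FKit.isomFtoDBijective_of_model fun x => ι_mapIso_bijective (K'.IsLocal x) _ _

/-- **Cor 5.6 (i) in abc-iut-w5-d217's kit form HOLDS for `FKit.ofBase`**: an isomorphism of its structured Θ-Hodge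
theaters is determined by, and freely given by, the induced isomorphism of associated `𝒟`-prime-strips (the
`𝔉^⊩`-component is forced by the compatibility of Def 3.6 (c), the local components by full faithfulness).
([IUTchI] Cor 5.6 (i) p.153) [claim: Mochizuki2012, status: disputed] -/
theorem cor56iKit_ofBase (K' : PMBaseKit.{u} l) (M : K'.MultKit) : (FKit.ofBase K' M).Cor56iKit := by
  intro H₁ H₂
  -- the `𝔉^⊩`-component of an isomorphism is forced by `compat` (Def 3.6 (c))
  have hrlf : ∀ φ : FKit.ThetaHT.Iso H₁ H₂, ∀ v,
      ((FKit.ofBase K' M).rlfFm v).map φ.rlfIso.hom =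
        ((H₁.rlf_fm v).hom ≫ ((FKit.ofBase K' M).toFm v).map (((FKit.ofBase K' M).thToF v).map (φ.thIso v).hom)) ≫
          (H₂.rlf_fm v).inv :=
    fun φ v => (Iso.eq_comp_inv (H₂.rlf_fm v)).mpr (φ.compat v)
  constructor
  · rintro ⟨t₁, r₁, c₁⟩ ⟨t₂, r₂, c₂⟩ h
    have hth : t₁ = t₂ := by
      funext v
      exact (ι_mapIso_bijective (K'.IsLocal v) _ _).1 (congrFun h v)
    subst hth
    have hr : r₁ = r₂ := by
      apply Iso.ext
      funext v
      exact (hrlf ⟨t₁, r₁, c₁⟩ v).trans (hrlf ⟨t₁, r₂, c₂⟩ v).symm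
    subst hr
    rfl
  · intro g
    have hsurj := fun v => (ι_mapIso_bijective (K'.IsLocal v) (H₁.th v) (H₂.th v)).2 (g v)
    choose t ht using hsurj
    exact ⟨⟨t, Pi.isoMk fun v => H₁.rlf_fm v ≪≫
        ((FKit.ofBase K' M).thToF v ⋙ (FKit.ofBase K' M).toFm v).mapIso (t v) ≪≫ (H₂.rlf_fm v).symm,
      fun v => comp_inv_comp_hom_aux (H₁.rlf_fm v)
        (((FKit.ofBase K' M).toFm v).map (((FKit.ofBase K' M).thToF v).map (t v).hom)) (H₂.rlf_fm v)⟩,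
      funext fun v => ht v⟩

variable (K : PMBaseKit.{0} l)

/-! ### Structured Θ-Hodge theaters of `FKit.ofBase` over the thickened kit and their isomorphisms -/

/-- The structured Θ-Hodge theater of the kit `FKit.ofBase` named by a family of isomorphs of the models (local data
and `𝔉^⊩`-data both the family, compatibility the identity). ([IUTchI] Def 3.6 p.87) [claim: Mochizuki2012, status: disputed] -/
noncomputable def thickHT (M : K.thicken.MultKit)
    (X : Core (∀ x : K.V, ObjectProperty.FullSubcategory (K.thicken.IsLocal x))) :
    (FKit.ofBase K.thicken M).ThetaHT where
  th := X.of
  th_isModel x := ⟨ObjectProperty.isoMk _ ((X.of x).property.some)⟩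
  rlf := X.of
  rlf_isModel := ⟨Pi.isoMk fun x => ObjectProperty.isoMk _ ((X.of x).property.some)⟩
  rlf_fm _ := Iso.refl _

/-- An isomorphism of the core groupoid induces an isomorphism of the structured Θ-Hodge theaters (local components
and `𝔉^⊩`-component both the given family of isomorphisms). ([IUTchI] Cor 5.6 (i) p.153) [claim: Mochizuki2012, status: disputed] -/
noncomputable def thickHTIso (M : K.thicken.MultKit)
    {X Y : Core (∀ x : K.V, ObjectProperty.FullSubcategory (K.thicken.IsLocal x))} (φ : X ≅ Y) :
    FKit.ThetaHT.Iso (K.thickHT M X) (K.thickHT M Y) where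
  thIso x := Pi.isoApp φ.hom.iso x
  rlfIso := φ.hom.iso
  compat _ := by
    change φ.hom.iso.hom _ ≫ 𝟙 _ = 𝟙 _ ≫ φ.hom.iso.hom _
    rw [Category.comp_id, Category.id_comp]

/-- `thickHTIso` is a bijection `Isom(X, Y) → Isom(†ℋ𝒯^Θ_X, †ℋ𝒯^Θ_Y)` (an isomorphism of structured Θ-Hodge theaters of
`FKit.ofBase` is determined by, and freely given by, its family of local components).
([IUTchI] Cor 5.6 (i) p.153) [claim: Mochizuki2012, status: disputed] -/
theorem thickHTIso_bijective (M : K.thicken.MultKit)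
    (X Y : Core (∀ x : K.V, ObjectProperty.FullSubcategory (K.thicken.IsLocal x))) :
    Function.Bijective (K.thickHTIso M : (X ≅ Y) → _) := by
  constructor
  · intro φ ψ h
    have h' : φ.hom.iso = ψ.hom.iso := congrArg FKit.ThetaHT.Iso.rlfIso h
    exact Iso.ext (CoreHom.ext h')
  · rintro ⟨t, r, hc⟩
    refine ⟨Core.isoMk r, ?_⟩
    have hr : (Core.isoMk r).hom.iso = r := Core.isoMk_hom_iso r
    have ht : ∀ x, Pi.isoApp r x = t x := fun x => by
      apply Iso.ext
      have hx := hc x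
      change r.hom x ≫ 𝟙 _ = 𝟙 _ ≫ (t x).hom at hx
      rw [Category.comp_id, Category.id_comp] at hx
      exact hx
    have key : ∀ (a : ∀ x, (K.thickHT M X).th x ≅ (K.thickHT M Y).th x) (b : (K.thickHT M X).rlf ≅ (K.thickHT M Y).rlf)
        (hb), a = t → b = r →
        (FKit.ThetaHT.Iso.mk a b hb : FKit.ThetaHT.Iso (K.thickHT M X) (K.thickHT M Y)) = ⟨t, r, hc⟩ := by
      rintro a b hb rfl rfl; rfl
    refine key _ _ _ (funext fun x => ?_) hr
    exact (congrArg (fun e => Pi.isoApp e x) hr).trans (ht x)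

variable [Fact l.Prime] (hl5 : 5 ≤ l) (hdis : Disjoint K.bad K.arc) (hbad : K.bad.Nonempty)

/-! ### A §5-R4 stub over the thickened datum with the same local categories -/

open ThickModel in
/-- **A §5-R4 stub over abc-iut-L5-t3's thickened datum** (KIT-RULE inhabitant of `BaseThetaDatum.S5Local` shaped on
the thickened kit): local ambient categories of `ℱ_v`-data := the datum's own categories of isomorphs of `𝒟_v` with
base functor the identity; global `ℱ^⊚`/`ℱ^⊛`-data := the one-object global category of the model with identity base;
Θ-Hodge theaters := the core groupoid of families `{†ℱ̲_v}_{v∈𝕍}` of isomorphs, the "tautologically associated"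
strip being the family itself; the valuation of a `φ^NF`-type morphism at `v` is `v`; restriction data trivial.
([IUTchI] Def 5.2 (i) p.134) [claim: Mochizuki2012, status: disputed] -/
noncomputable def thickS5Local : (K.thickDatum hl5 hdis hbad).S5Local where
  FAmb x := ObjectProperty.FullSubcategory (K.thicken.IsLocal x)
  F x := ⟨K.thicken.model x, K.thicken.isLocal_model x⟩
  nonempty_isoF _ X Y := ⟨ObjectProperty.isoMk _ (X.property.some ≪≫ Y.property.some.symm)⟩
  base _ := 𝟭 _
  FAmbG := GlobAmb l
  FG := SingleObj.star _
  nonempty_isoFG _ _ := ⟨Iso.refl _⟩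
  baseG Y := Y
  baseGIso b := b
  baseGIso_refl _ := rfl
  baseGIso_trans _ _ := rfl
  FAmbGlob := GlobAmb l
  FGlob := SingleObj.star _
  nonempty_isoFGlob _ _ := ⟨Iso.refl _⟩
  DashArrow _ _ := PUnit
  dashModel := PUnit.unit
  restrictAt _ _ x := ⟨K.thicken.model x, K.thicken.isLocal_model x⟩
  ThetaHT := Core (∀ x : K.V, ObjectProperty.FullSubcategory (K.thicken.IsLocal x))
  HT := ⟨fun x => ⟨K.thicken.model x, K.thicken.isLocal_model x⟩⟩
  nonempty_isoHT X Y :=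
    ⟨Core.isoMk (Pi.isoMk fun x => ObjectProperty.isoMk _ ((X.of x).property.some ≪≫ (Y.of x).property.some.symm))⟩
  assocStrip X x := X.of x
  assocStripIso φ x := Pi.isoApp φ.hom.iso x
  valOfNF {x} _ _ _ := x
  valOfNF_postNF _ _ := rfl
  valOfNF_preNF _ _ := rfl
  valOfNF_phiNF _ := rfl
  RestrictionDatum _ _ := PUnit
  restrictionOf _ _ _ := PUnit.unit

/-! ### The ℱ-level core agreement on the model, every field by identities -/

/-- **`FKitCore` is inhabited**: the §5-R4 stub `thickS5Local` core-agrees, over `thickCore` (`e = id`), with the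
ℱ-kit `FKit.ofBase K.thicken M` — comparison functors the identities, `baseComm` the identity (both base functors
are the inclusion of the isomorphs of `𝒟_v`), Θ-Hodge theaters compared by `thickHT`/`thickHTIso` (bijective on
isomorphisms), associated strips literally equal. ([IUTchI] Def 5.2 (i) p.134) [claim: Mochizuki2012, status: disputed] -/
noncomputable def thickFKitCore (M : K.thicken.MultKit) :
    (K.thickS5Local hl5 hdis hbad).FKitCore (K.thickCore hl5 hdis hbad) (FKit.ofBase K.thicken M) where
  famb _ := 𝟭 _
  fambFF _ := Functor.FullyFaithful.id _
  fambModel _ := Iso.refl _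
  baseComm _ := Iso.refl _
  ht := K.thickHT M
  htIso φ := K.thickHTIso M φ
  htIso_bijective := K.thickHTIso_bijective M
  assocIso _ _ := Iso.refl _
  assoc_natural φ x := by
    change (Pi.isoApp φ.hom.iso x).hom ≫ 𝟙 _ = 𝟙 _ ≫ (Pi.isoApp φ.hom.iso x).hom
    rw [Category.comp_id, Category.id_comp]

/-! ### The junction fires on the inhabitant -/

/-- **[IUTchI] Cor 5.6 (i) HOLDS for the §5-R4 stub `thickS5Local`** — the chain of `FKitCoreBridge.lean` composes on
the inhabitant: `cor56i_of_cor56iKit` fed with `thickFKitCore` (`e = id` bijective), `cor56iKit_ofBase` and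
`isomFtoDBijective_ofBase` yields abc-iut-L5-t3's frozen node statement `S5Local.Cor56i` for this `S5Local` (a kernel
instance of the junction, not a claim about print's kit). ([IUTchI] Cor 5.6 (i) p.153) [claim: Mochizuki2012, status: disputed] -/
theorem thick_cor56i (M : K.thicken.MultKit) :
    BaseThetaDatum.S5Local.Cor56i (K.thickS5Local hl5 hdis hbad) :=
  (K.thickFKitCore hl5 hdis hbad M).cor56i_of_cor56iKit (K.thickCore_e_bijective hl5 hdis hbad).2
    (cor56iKit_ofBase K.thicken M) (isomFtoDBijective_ofBase K.thicken M)

/-! ### Packaged existence -/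

/-- **KIT-RULE for `FKitCore`**: for every prime `l ≥ 5` there exist a §4 datum `𝔡`, a §5-R4 stub `S` over it, a
base kit `K` with a `KitCore` `c` whose index comparison `c.e` is BIJECTIVE (so the junction theorems'
`he : Surjective c.e` is met), a multiplicative kit, an ℱ-kit and an `FKitCore` between them; moreover `𝕍^bad ≠ ∅`.
So `FKitCore.cor56i_of_rows` / `cor56i_of_cor56iKit` of `FKitCoreBridge.lean` are not vacuous.
([IUTchI] Def 5.2 (i) p.134) [claim: Mochizuki2012, status: disputed] -/
theorem exists_fKitCore (l : ℕ) [Fact l.Prime] (hl5 : 5 ≤ l) :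
    ∃ (𝔡 : BaseThetaDatum.{0}) (S : 𝔡.S5Local) (K : PMBaseKit.{0} 𝔡.l) (c : 𝔡.KitCore K) (M : K.MultKit)
      (FK : K.FKit M) (_ : S.FKitCore c FK), 𝔡.l = l ∧ Function.Bijective c.e ∧ K.bad.Nonempty := by
  classical
  have hl2 : l ≠ 2 := by omega
  let K : PMBaseKit.{0} l := { toyKit l hl2 with bad := ({PUnit.unit} : Finset Unit), arc := ∅ }
  have hdis : Disjoint K.bad K.arc := Finset.disjoint_empty_right _
  have hbad : K.bad.Nonempty := ⟨PUnit.unit, Finset.mem_singleton_self _⟩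
  exact ⟨K.thickDatum hl5 hdis hbad, K.thickS5Local hl5 hdis hbad, K.thicken, K.thickCore hl5 hdis hbad,
    K.thickMultKit hl5 hdis hbad, FKit.ofBase K.thicken _, K.thickFKitCore hl5 hdis hbad _, rfl,
    K.thickCore_e_bijective hl5 hdis hbad, hbad⟩

end PMBaseKit

end Literature.IUT.HodgeTheaters
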